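import Mathlib
import Summits.Ventures.PercRepro2.Defs
import Summits.Ventures.PercRepro2.Independence
import Summits.Ventures.PercRepro2.Harris
import Summits.Ventures.PercRepro2.Graph
import Summits.Ventures.PercRepro2.Exploration
import Summits.Ventures.PercRepro2.Events
import Summits.Ventures.PercRepro2.FourFunctions
import Summits.Ventures.PercRepro2.Induced
import Summits.Ventures.PercRepro2.Frontier
import Summits.Ventures.PercRepro2.ObsIndependence
import Summits.Ventures.PercRepro2.BHK
import Summits.Ventures.PercRepro2.BHKEvents
import Summits.Ventures.PercRepro2.MultiSource
import Summits.Ventures.PercRepro2.OrderPreservation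
import Summits.Ventures.PercRepro2.SeedSet
import Summits.Ventures.PercRepro2.MultiSourceFun
import Summits.Ventures.PercRepro2.CrossRootT
import Summits.Ventures.PercRepro2.VdBKahn
import Summits.Ventures.PercRepro2.GateDefs
import Summits.Ventures.PercRepro2.GateFrame

/-!
# THEOREM (MARKER GATE): the first theorem of row 2′CON-W beyond the s/T-edge cases
(blind cell PercRepro2, typer-1; mine-c g6 MINE-C.md §13.8, INBOX 2026-08-23T16:30:22Z; lead g11
16:30:35Z "`GateRow_marker` … three bhk_induced + hull-frame PA + one ring identity")

For a marker `a` of `X = {a ∈ C(s)}` and ANY `B`, `Φ(R_T ∖ {a ∈ S ∧ hull(T) ∩ B ≠ ∅}) ≥ 0`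
(`Gate.GateRow p ends s T a b {a} B`). On the gate `X` is determined (`0` on `{a ∉ S}`, `1` on
`{a ∈ S, K avoids B}`), and with `r = P(R)`, `x = P(X; R)`, `y = P(Y; R)`, `xy = P(XY; R)`,
`q = P(X; R, K avoids B)`, `qy = P(XY; R, K avoids B)` the cleared `Φ` is EXACTLY

  `Φ = (r − x) · (r · qy − q · y) + x · (r · xy − x · y)`   (`gate_marker_identity`).

`r · xy − x · y ≥ 0` is BHK 1.3 (`vdBK`). `r · qy − q · y ≥ 0` is mine-c's chain
`E[Y | a ∈ S, K avoids B] ≥ E[Y | K avoids B] ≥ E[Y]` (given `R`):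
(i) `qy · d ≥ q · yq` (`d = P(R, K avoids B)`, `yq = P(Y; R, K avoids B)`): positive association of
`X, Y` given `R ∩ {K avoids B}` — the hull frame: explore `K = C(T)`; given `K = W` the events are
the increasing `{a ∈ C_{G−W}(s)}`, `{b ∈ C_{G−W}(s)}` with Harris in `G − W`
(`delClusterProb_mul_le`), and the decreasing functionals `g_a, g_b` of `K` are positively
correlated under the seed-set BHK with the avoided set `{s} ∪ B` (`bhk_multi`), through the tower
identity `prob_clusterSetIn_inter_eq_expect`;
(ii) `yq · r ≥ y · d`: `Y` and `{K hits B}` are negatively correlated given `R`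
(`bhk_cross_clusterT`, up-sets `{W | W hits B}` and `{S | b ∈ S}`).
Hence `d · (r · qy − q · y) ≥ 0`, and `d = 0` forces `q = qy = 0`.

* **`GateRow_marker`**: `GateRow p ends s T a b {a} B` for every admissible `p` — no hypothesis on
  `s, T, a, b, B` is needed; by the symmetry `a ↔ b` of the row the marker gate `{b}` holds too.
-/

namespace Summit.Ventures.PercRepro2

namespace Gate

open scoped Classical

variable {V : Type*} {E : Type*} [Fintype E] [DecidableEq E] [Fintype V] [DecidableEq V]
  {R : Type*} [Field R] [LinearOrder R] [IsStrictOrderedRing R]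

/-! ## The theorem -/

section Main

variable (p : E → R) (ends : E → Sym2 V) (s : V) (T B : Finset V) (a b : V)

omit [Fintype E] [DecidableEq E] [Fintype V] [DecidableEq V] [LinearOrder R] [IsStrictOrderedRing R] in
/-- The gate at `A = {a}` meets `X` in `X ∩ R ∩ {K avoids B}`. -/
lemma X_inter_gate_eq :
    connAll ends s {a} ∩ gateEvent ends s T {a} B =
      connAll ends s {a} ∩ (avoidAll ends s T ∩ (hitsK ends T B)ᶜ) := by
  ext ω
  simp only [gateEvent, hitsS_singleton, Set.mem_inter_iff, Set.mem_compl_iff, not_and]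
  tauto

omit [Fintype E] [DecidableEq E] [Fintype V] [LinearOrder R] [IsStrictOrderedRing R] in
/-- The gate at `A = {a}` meets `XY` in `XY ∩ R ∩ {K avoids B}`. -/
lemma XY_inter_gate_eq :
    connAll ends s ({a} ∪ {b}) ∩ gateEvent ends s T {a} B =
      connAll ends s ({a} ∪ {b}) ∩ (avoidAll ends s T ∩ (hitsK ends T B)ᶜ) := by
  ext ω
  simp only [gateEvent, hitsS_singleton, connAll_pair_eq, Set.mem_inter_iff, Set.mem_compl_iff,
    not_and]
  tauto

omit [Fintype V] [LinearOrder R] [IsStrictOrderedRing R] in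
/-- `P(Y; gate) = P(Y; R) − P(XY; R) + P(XY; R, K avoids B)`. -/
lemma prob_Y_inter_gate :
    prob p (connAll ends s {b} ∩ gateEvent ends s T {a} B) =
      prob p (connAll ends s {b} ∩ avoidAll ends s T) -
        prob p (connAll ends s ({a} ∪ {b}) ∩ avoidAll ends s T) +
        prob p (connAll ends s ({a} ∪ {b}) ∩ (avoidAll ends s T ∩ (hitsK ends T B)ᶜ)) := by
  have hsplit := prob_inter_add_prob_inter_compl p (connAll ends s {b} ∩ gateEvent ends s T {a} B)
    (connAll ends s {a})
  have e1 : connAll ends s {b} ∩ gateEvent ends s T {a} B ∩ connAll ends s {a} =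
      connAll ends s ({a} ∪ {b}) ∩ (avoidAll ends s T ∩ (hitsK ends T B)ᶜ) := by
    rw [← XY_inter_gate_eq, connAll_pair_eq]
    ext ω; simp only [Set.mem_inter_iff]; tauto
  have e2 : connAll ends s {b} ∩ gateEvent ends s T {a} B ∩ (connAll ends s {a})ᶜ =
      connAll ends s {b} ∩ avoidAll ends s T ∩ (connAll ends s {a})ᶜ := by
    ext ω
    simp only [gateEvent, hitsS_singleton, Set.mem_inter_iff, Set.mem_compl_iff, not_and]
    tauto
  have hsplit2 := prob_inter_add_prob_inter_compl p (connAll ends s {b} ∩ avoidAll ends s T)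
    (connAll ends s {a})
  have e3 : connAll ends s {b} ∩ avoidAll ends s T ∩ connAll ends s {a} =
      connAll ends s ({a} ∪ {b}) ∩ avoidAll ends s T := by
    rw [connAll_pair_eq]; ext ω; simp only [Set.mem_inter_iff]; tauto
  rw [e1, e2] at hsplit
  rw [e3] at hsplit2
  linear_combination hsplit2 - hsplit

omit [Fintype V] [DecidableEq V] [LinearOrder R] [IsStrictOrderedRing R] in
/-- `P(gate) = P(R) − P(X; R) + P(X; R, K avoids B)`. -/
lemma prob_gate_singleton :
    prob p (gateEvent ends s T {a} B) =
      prob p (avoidAll ends s T) - prob p (connAll ends s {a} ∩ avoidAll ends s T) +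
        prob p (connAll ends s {a} ∩ (avoidAll ends s T ∩ (hitsK ends T B)ᶜ)) := by
  have hsplit := prob_inter_add_prob_inter_compl p (gateEvent ends s T {a} B) (connAll ends s {a})
  have e1 : gateEvent ends s T {a} B ∩ connAll ends s {a} =
      connAll ends s {a} ∩ (avoidAll ends s T ∩ (hitsK ends T B)ᶜ) := by
    rw [← X_inter_gate_eq, Set.inter_comm]
  have e2 : gateEvent ends s T {a} B ∩ (connAll ends s {a})ᶜ =
      avoidAll ends s T ∩ (connAll ends s {a})ᶜ := by
    ext ω
    simp only [gateEvent, hitsS_singleton, Set.mem_inter_iff, Set.mem_compl_iff, not_and]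
    tauto
  have hsplit2 := prob_inter_add_prob_inter_compl p (avoidAll ends s T) (connAll ends s {a})
  rw [Set.inter_comm] at hsplit2
  rw [e1, e2] at hsplit
  linear_combination hsplit2 - hsplit

omit [DecidableEq V] [LinearOrder R] [IsStrictOrderedRing R] in
/-- **The exact identity**: with `r = P(R)`, `x = P(X; R)`, `y = P(Y; R)`, `xy = P(XY; R)`,
`q = P(X; R′)`, `qy = P(XY; R′)`, the cleared marker-gate expression is
`(r − x)(r·qy − q·y) + x(r·xy − x·y)`. -/
lemma gate_marker_identity (r x y xy q qy : R) :
    r ^ 2 * qy - r * (x * (y - xy + qy) + y * q) + x * y * (r - x + q) =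
      (r - x) * (r * qy - q * y) + x * (r * xy - x * y) := by
  ring

/-- **THEOREM (MARKER GATE)** (mine-c §13.8): `GateRow p ends s T a b {a} B` for every admissible
`p` — the gate removing the class `{a ∈ S ∧ K hits B}` keeps the centred rung nonnegative. -/
theorem GateRow_marker (hp : IsProbVec p) : GateRow p ends s T a b {a} B := by
  unfold GateRow
  rw [XY_inter_gate_eq, X_inter_gate_eq, prob_Y_inter_gate, prob_gate_singleton]
  set r := prob p (avoidAll ends s T) with hr
  set x := prob p (connAll ends s {a} ∩ avoidAll ends s T) with hx
  set y := prob p (connAll ends s {b} ∩ avoidAll ends s T) with hy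
  set xy := prob p (connAll ends s ({a} ∪ {b}) ∩ avoidAll ends s T) with hxy
  set q := prob p (connAll ends s {a} ∩ (avoidAll ends s T ∩ (hitsK ends T B)ᶜ)) with hq
  set qy := prob p (connAll ends s ({a} ∪ {b}) ∩ (avoidAll ends s T ∩ (hitsK ends T B)ᶜ)) with hqy
  set yq := prob p (connAll ends s {b} ∩ (avoidAll ends s T ∩ (hitsK ends T B)ᶜ)) with hyq
  set d := prob p (avoidAll ends s T ∩ (hitsK ends T B)ᶜ) with hd
  rw [gate_marker_identity]
  -- BHK 1.3: `x · y ≤ xy · r`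
  have hD₂ : 0 ≤ r * xy - x * y := by
    have h := vdBK p hp ends s {a} {b} T T
    rw [Finset.inter_self, Finset.union_self] at h
    linarith [h]
  -- (i) and (ii)
  have hi := hull_frame_pa p ends s T B a b hp
  have hii := hits_Y_le p ends s T B b hp
  -- complements: `yq = y − P(hits ∩ Y ∩ R)`, `d = r − P(hits ∩ R)`
  have hyq' : yq = y - prob p (hitsK ends T B ∩ connAll ends s {b} ∩ avoidAll ends s T) := by
    have h := prob_inter_add_prob_inter_compl p (connAll ends s {b} ∩ avoidAll ends s T)
      (hitsK ends T B)
    have e1 : connAll ends s {b} ∩ avoidAll ends s T ∩ hitsK ends T B =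
        hitsK ends T B ∩ connAll ends s {b} ∩ avoidAll ends s T := by
      ext ω; simp only [Set.mem_inter_iff]; tauto
    have e2 : connAll ends s {b} ∩ avoidAll ends s T ∩ (hitsK ends T B)ᶜ =
        connAll ends s {b} ∩ (avoidAll ends s T ∩ (hitsK ends T B)ᶜ) := by
      rw [Set.inter_assoc]
    rw [e1, e2] at h
    linarith [h]
  have hd' : d = r - prob p (hitsK ends T B ∩ avoidAll ends s T) := by
    have h := prob_inter_add_prob_inter_compl p (avoidAll ends s T) (hitsK ends T B)
    rw [Set.inter_comm (avoidAll ends s T) (hitsK ends T B)] at h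
    linarith [h]
  -- (ii): `yq · r ≥ y · d`
  have hii' : y * d ≤ yq * r := by
    rw [hyq', hd']
    nlinarith [hii]
  -- `d · (r · qy − q · y) ≥ 0`
  have hd0 : 0 ≤ d := prob_nonneg hp _
  have hq0 : 0 ≤ q := prob_nonneg hp _
  have hr0 : 0 ≤ r := prob_nonneg hp _
  have hy0 : 0 ≤ y := prob_nonneg hp _
  have hqd : q ≤ d := prob_mono hp Set.inter_subset_right
  have hqyq : qy ≤ q := prob_mono hp (Set.inter_subset_inter_left _ (by
    rw [connAll_pair_eq]; exact Set.inter_subset_left))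
  have hqy0 : 0 ≤ qy := prob_nonneg hp _
  have hD₁ : 0 ≤ r * qy - q * y := by
    rcases hd0.lt_or_eq with hdpos | hdzero
    · -- `qy · d · r ≥ q · yq · r ≥ q · y · d`
      have h1 : q * y * d ≤ qy * d * r := by
        calc q * y * d = q * (y * d) := by ring
          _ ≤ q * (yq * r) := mul_le_mul_of_nonneg_left hii' hq0
          _ = (q * yq) * r := by ring
          _ ≤ (qy * d) * r := mul_le_mul_of_nonneg_right hi hr0
      have h2 : 0 ≤ d * (r * qy - q * y) := by nlinarith [h1]
      exact nonneg_of_mul_nonneg_right h2 hdpos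
    · have hq' : q = 0 := le_antisymm (hdzero ▸ hqd) hq0
      have hqy' : qy = 0 := le_antisymm (hq' ▸ hqyq) hqy0
      rw [hq', hqy']; simp
  have hxr : x ≤ r := prob_mono hp Set.inter_subset_right
  have hx0 : 0 ≤ x := prob_nonneg hp _
  exact add_nonneg (mul_nonneg (sub_nonneg.2 hxr) hD₁) (mul_nonneg hx0 hD₂)

/-- The marker gate at `b` (the row is symmetric in `a ↔ b`): `GateRow p ends s T a b {b} B`. -/
theorem GateRow_marker' (hp : IsProbVec p) : GateRow p ends s T a b {b} B := by
  have h := GateRow_marker p ends s T B b a hp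
  unfold GateRow at h ⊢
  rw [Finset.union_comm] at h
  linarith [h]

end Main

end Gate

end Summit.Ventures.PercRepro2
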